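import Literature.Probability.Entropy.EntropyMethodNecessity
import HarnessLib

/-!
# Stub S12 `stub_measure_le_exp_of_entropyClass` of crux stmt-AtomisticToContinuum-13080
(`JParityClosure.RateFloor`, line `Sketch`): the entropy method needs a large-deviation bound — hull form

Registered stub `stub_measure_le_exp_of_entropyClass` (S12) of the lead's skeleton of the line `Sketch` for the
crux `Summit.AtomisticToContinuum.HydrodynamicLimit.Theses.JParityClosure.RateFloor`
(`--supports stmt-AtomisticToContinuum-13080`).

Statement.  For a probability law `ν` on any measurable space, ANY set `E` (no measurability assumed) and reals
`K`, `δ < 1`: if every probability law `μ` with `KL(μ ‖ ν) ≤ K` gives `E` mass `≤ δ`, then `ν(E) ≤ e^{−K}`.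

Proof (the trivial half of the Donsker–Varadhan duality, by conditioning; Kipnis–Landim 1999, Appendix 1 §8).
If `e^{−K} ≥ 1` the claim is `ν(E) ≤ 1`.  Otherwise suppose `ν(E) > e^{−K}` and let `E' := toMeasurable ν E`
be the measurable hull (`E ⊆ E'`, `ν(E') = ν(E) > 0`).  The conditioned law `μ := ν(· | E')` is a probability
law with `KL(μ ‖ ν) = −log ν(E') ≤ K` (tree: `Literature.Probability.Entropy.toReal_klDiv_cond`,
`klDiv_cond_ne_top`), and `μ(E) = ν(E')⁻¹ ν(E' ∩ E) = ν(E')⁻¹ ν(E) = 1` (`cond_apply` needs only `E'`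
measurable, and `E' ∩ E = E`).  The hypothesis then gives `1 = μ(E) ≤ δ < 1`, a contradiction. [folklore]
-/

noncomputable section

namespace Summit.AtomisticToContinuum.HydrodynamicLimit.Theorems.RateFloorEntropyNecessity

open MeasureTheory ProbabilityTheory InformationTheory
open scoped ENNReal

/-- Entropy of the law conditioned on a measurable event of reference mass at least `e^{−K}` is at most `K`:
`KL(ν(· | A) ‖ ν) = −log ν(A) ≤ K`. [cite: KipnisLandim1999, Appendix 1 §8] [folklore] -/
theorem klDiv_cond_le_ofReal {α : Type*} [MeasurableSpace α] (ν : Measure α) [IsProbabilityMeasure ν]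
    {A : Set α} (hA : MeasurableSet A) {K : ℝ} (hK : Real.exp (-K) ≤ ν.real A) :
    klDiv (ν[|A]) ν ≤ ENNReal.ofReal K := by
  -- adapted from `Literature.Probability.Entropy.exists_klDiv_le_and_apply_eq_one`
  have hq : 0 < ν.real A := lt_of_lt_of_le (Real.exp_pos _) hK
  have hA0 : ν A ≠ 0 := by
    intro h; simp [measureReal_def, h] at hq
  have hlog := Real.log_le_log (Real.exp_pos _) hK
  rw [Real.log_exp] at hlog
  have hle : Real.log (ν.real A) ≤ 0 := Real.log_nonpos hq.le measureReal_le_one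
  rw [ENNReal.le_ofReal_iff_toReal_le (Literature.Probability.Entropy.klDiv_cond_ne_top ν hA hA0) (by linarith),
    Literature.Probability.Entropy.toReal_klDiv_cond ν hA hA0]
  linarith

/-- The law conditioned on the measurable hull `toMeasurable ν E` of a set `E` of nonzero (outer) mass gives `E`
full mass: `ν(E | toMeasurable ν E) = 1`, since `ν(toMeasurable ν E ∩ E) = ν(E) = ν(toMeasurable ν E)`. [folklore] -/
theorem cond_toMeasurable_apply_self {α : Type*} [MeasurableSpace α] (ν : Measure α) [IsFiniteMeasure ν]
    {E : Set α} (hE0 : ν E ≠ 0) : ν[E | toMeasurable ν E] = 1 := by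
  rw [cond_apply (measurableSet_toMeasurable ν E) ν E, Set.inter_eq_right.2 (subset_toMeasurable ν E),
    measure_toMeasurable E]
  exact ENNReal.inv_mul_cancel hE0 (measure_ne_top ν E)

/-- **S12 · the entropy method needs a large-deviation bound at the speed of its budget — hull form.**
For a probability law `ν`, ANY set `E` and reals `K`, `δ < 1`: if every probability law `μ` with
`KL(μ ‖ ν) ≤ K` gives `E` mass `≤ δ`, then `ν(E) ≤ e^{−K}` (Donsker–Varadhan duality by conditioning on the
measurable hull of `E`). [cite: KipnisLandim1999, Appendix 1 §8] [folklore] -/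
theorem stub_measure_le_exp_of_entropyClass :
    ∀ (α : Type) [MeasurableSpace α] (ν : MeasureTheory.Measure α) [MeasureTheory.IsProbabilityMeasure ν] (E : Set α) (K δ : ℝ), δ < 1 → (∀ μ : MeasureTheory.Measure α, MeasureTheory.IsProbabilityMeasure μ → InformationTheory.klDiv μ ν ≤ ENNReal.ofReal K → μ E ≤ ENNReal.ofReal δ) → ν E ≤ ENNReal.ofReal (Real.exp (-K)) := by
  intro α _ ν _ E K δ hδ h
  by_contra hlt
  have hlt : ENNReal.ofReal (Real.exp (-K)) < ν E := not_le.mp hlt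
  have hE0 : ν E ≠ 0 := (lt_of_le_of_lt bot_le hlt).ne'
  have hE'0 : ν (toMeasurable ν E) ≠ 0 := by rwa [measure_toMeasurable]
  have hK : Real.exp (-K) ≤ ν.real (toMeasurable ν E) := by
    rw [measureReal_def, measure_toMeasurable]
    exact ((ENNReal.ofReal_lt_iff_lt_toReal (Real.exp_pos _).le (measure_ne_top ν E)).1 hlt).le
  haveI : IsProbabilityMeasure (ν[|toMeasurable ν E]) := cond_isProbabilityMeasure hE'0
  have h1 := h (ν[|toMeasurable ν E]) inferInstance
    (klDiv_cond_le_ofReal ν (measurableSet_toMeasurable ν E) hK)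
  rw [cond_toMeasurable_apply_self ν hE0] at h1
  exact absurd (lt_of_le_of_lt h1 (ENNReal.ofReal_lt_one.2 hδ)) (lt_irrefl 1)

end Summit.AtomisticToContinuum.HydrodynamicLimit.Theorems.RateFloorEntropyNecessity

end
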